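import Summits.Ventures.PercRepro.RankLevelSetHallEqSplit

/-!
# PercRepro — THE WITHIN-`S` TILT (R11): LOADS ≤ 1 AND THE TRANSFER TO THE UP-HALL FORM
(p4, gen 39; paper proofs/P4-TILT-S.md; C-044, UP form, tight layer `#E = p + q`, any `k`)

The `d`-tilted split R10 (RankLevelSetHallTiltSplit) weights a member `T` inside a `Y`-set `S` by its GLOBAL deficit
`d(T) = #(cl T ∖ T)`, which no member of `S` can bound from its own data.  THE WITHIN-`S` TILT replaces it by the deficit
of `T` INSIDE `S`: `d_S(T) = #((cl T ∩ S) ∖ T)` — the size of the closure flat of `T` in `M|S` minus `q` — and the members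
of `S` share the unit in proportion to `θ_S(T) = 1 + τ · d_S(T)/q` (`tiltSDef`, `tiltSTheta`, `tiltSWeight`; `τ = 0` is the
equal split).  THIS FILE: for `τ ≥ 0` the weight is non-negative, supported on `Z ⊆ S`, and every `Y`-set is loaded at most `1`
(`tiltSWeight_load_le_one`, exactly `1` when `S` contains a member).  `TiltSRecv M p q τ` (a `Prop`, NOT asserted: every
member receives at least `Φ(p,q)`) gives the UP-Hall condition for every family (`hallUp_of_tiltS`).
Why this kernel (p4 g39, exact): the denominator `Σ_{T ⊆ S} θ_S(T) = m(S) + (τ/q)·#{(T, z) : T member, z ∈ (cl T ∩ S) ∖ T}`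
is `Z`-LOCAL — every pair `(T, z)` with `T ⊄ cl Z` has `W = T ∪ {z}` of rank `q` with either `W ∖ cl Z` dependent over `cl Z`
or `W ∩ cl Z` dependent (submodularity; RankLevelSetHallTiltSLost) — so a member sees its competitors' tilts through the
dependent sets of `M/cl Z` and of `M|cl Z` alone.  On `M₀(q,d,k) = U_{q,q+d} ⊕ Free(q−d+k)` (where every `d`-blind rule fails
from `q = 72`) the type receipts are `≥ 1.087·Φ` at `(80,74,14)` and `≥ 1.012·Φ` at `(150,145,14)` for `τ = 1`; min `≥ 1` on
the random `n ≤ 11` census and the fat-class / kernel-A-killer families for `τ ∈ {1,2,4}`.  NOT proved.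

* `tiltSDef`, `tiltSTheta`, `tiltSWeight`;
* `tiltSTheta_pos`, `tiltSWeight_nonneg`, `subset_of_tiltSWeight_ne_zero`, **`tiltSWeight_load_le_one`**;
* `TiltSRecv`, **`hallUp_of_tiltS`**.
Axioms: standard.
-/

namespace PercRepro

open Set Matroid Finset

variable {α : Type} (M : Matroid α) [M.Finite]

omit [M.Finite] in
/-- `d_S(T) = #((cl T ∩ S) ∖ T)`: the deficit of `T` inside `S` (the closure flat of `T` in `M|S`, minus `T`). -/
noncomputable def tiltSDef (S T : Set α) : ℕ := ((M.closure T ∩ S) \ T).ncard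

omit [M.Finite] in
/-- `θ_S(T) = 1 + τ · d_S(T)/q`. -/
noncomputable def tiltSTheta (q : ℕ) (τ : ℚ) (S T : Set α) : ℚ :=
  1 + τ * ((tiltSDef M S T : ℕ) : ℚ) / (q : ℚ)

/-- **The within-`S` tilted weight** of the member `Z` at the `Y`-set `S`: `θ_S(Z) / Σ_{Z' ⊆ S} θ_S(Z')` when `Z ⊆ S`,
`0` otherwise. -/
noncomputable def tiltSWeight (p q : ℕ) (τ : ℚ) (Z S : Set α) : ℚ := by
  classical
  exact if Z ∈ cellMembers M p q ∧ Z ⊆ S ∧ S ∈ cellY M p q then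
    tiltSTheta M q τ S Z / ∑ Z' ∈ (eqMembers_finite M p q S).toFinset, tiltSTheta M q τ S Z' else 0

omit [M.Finite] in
/-- `θ_S(T) ≥ 1 > 0` for `τ ≥ 0`. -/
theorem tiltSTheta_pos (q : ℕ) {τ : ℚ} (hτ : 0 ≤ τ) (S T : Set α) : 0 < tiltSTheta M q τ S T := by
  unfold tiltSTheta
  have : 0 ≤ τ * ((tiltSDef M S T : ℕ) : ℚ) / (q : ℚ) := by positivity
  linarith

/-- The weight is non-negative for `τ ≥ 0`. -/
theorem tiltSWeight_nonneg (p q : ℕ) {τ : ℚ} (hτ : 0 ≤ τ) (Z S : Set α) : 0 ≤ tiltSWeight M p q τ Z S := by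
  classical
  unfold tiltSWeight
  split_ifs
  · exact div_nonneg (tiltSTheta_pos M q hτ S Z).le
      (Finset.sum_nonneg (fun Z' _ => (tiltSTheta_pos M q hτ S Z').le))
  · exact le_rfl

/-- The weight is supported on the pairs `Z ⊆ S`. -/
theorem subset_of_tiltSWeight_ne_zero (p q : ℕ) (τ : ℚ) (Z S : Set α) (h : tiltSWeight M p q τ Z S ≠ 0) :
    Z ⊆ S := by
  classical
  by_contra hZS
  apply h
  unfold tiltSWeight
  rw [if_neg (fun hc => hZS hc.2.1)]

/-- **Every `Y`-set is loaded at most `1`** (exactly `1` when it contains a member): the shares are proportional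
to `θ_S`. -/
theorem tiltSWeight_load_le_one (p q : ℕ) {τ : ℚ} (hτ : 0 ≤ τ) {S : Set α} (hS : S ∈ cellY M p q) :
    ∑ Z ∈ (cellMembers_finite M p q).toFinset, tiltSWeight M p q τ Z S ≤ 1 := by
  classical
  set Mf : Finset (Set α) := (cellMembers_finite M p q).toFinset with hMf
  have hmemM : ∀ Z, Z ∈ Mf ↔ Z ∈ cellMembers M p q := fun Z => by
    rw [hMf, (cellMembers_finite M p q).mem_toFinset]
  set Ef : Finset (Set α) := (eqMembers_finite M p q S).toFinset with hEf
  have hmemE : ∀ Z, Z ∈ Ef ↔ Z ∈ cellMembers M p q ∧ Z ⊆ S := fun Z => by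
    rw [hEf, (eqMembers_finite M p q S).mem_toFinset]
    rfl
  set Θ : ℚ := ∑ Z' ∈ Ef, tiltSTheta M q τ S Z' with hΘ
  have hw : ∀ Z ∈ Mf, tiltSWeight M p q τ Z S = if Z ⊆ S then tiltSTheta M q τ S Z / Θ else 0 := by
    intro Z hZ
    rw [hmemM] at hZ
    unfold tiltSWeight
    by_cases hZS : Z ⊆ S
    · rw [if_pos ⟨hZ, hZS, hS⟩, if_pos hZS]
    · rw [if_neg (fun hc => hZS hc.2.1), if_neg hZS]
  rw [Finset.sum_congr rfl hw, Finset.sum_ite, Finset.sum_const_zero, add_zero]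
  have hfilter : Mf.filter (fun Z => Z ⊆ S) = Ef := by
    ext Z
    rw [Finset.mem_filter, hmemM, hmemE]
  rw [hfilter]
  by_cases hE : Ef = ∅
  · rw [hE, Finset.sum_empty]
    exact zero_le_one
  · have hΘpos : 0 < Θ := by
      obtain ⟨Z₀, hZ₀⟩ := Finset.nonempty_iff_ne_empty.2 hE
      rw [hΘ]
      exact Finset.sum_pos (fun Z' _ => tiltSTheta_pos M q hτ S Z') ⟨Z₀, hZ₀⟩
    rw [← Finset.sum_div, ← hΘ, div_self hΘpos.ne']

/-- **The within-`S` tilted receipt condition** (a `Prop`, NOT asserted): every member receives at least `Φ(p,q)`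
under the within-`S` tilt with parameter `τ`.  The candidate of record for `k ≥ 3` (`τ = 1`). -/
def TiltSRecv (p q : ℕ) (τ : ℚ) : Prop :=
  ∀ Z ∈ cellMembers M p q, phiK p q ≤ ∑ S ∈ (cellY_finite M p q).toFinset, tiltSWeight M p q τ Z S

/-- **THE TRANSFER**: for `τ ≥ 0`, `TiltSRecv M p q τ` gives the UP-Hall condition for every family of members
(through night-1's `hallUp_of_fracMatching`; no tight-layer hypothesis is needed for the loads). -/
theorem hallUp_of_tiltS (p q : ℕ) {τ : ℚ} (hτ : 0 ≤ τ) (h : TiltSRecv M p q τ) (𝒜 : Set (Set α))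
    (h𝒜 : 𝒜 ⊆ cellMembers M p q) :
    phiK p q * (𝒜.ncard : ℚ) ≤ ((upNbhd M p q 𝒜).ncard : ℚ) :=
  hallUp_of_fracMatching M p q (tiltSWeight M p q τ) (tiltSWeight_nonneg M p q hτ)
    (subset_of_tiltSWeight_ne_zero M p q τ) (fun _ hZ => h _ hZ)
    (fun _ hS => tiltSWeight_load_le_one M p q hτ hS) 𝒜 h𝒜

end PercRepro
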